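import Summits.BirchSwinnertonDyer.BirchSwinnertonDyer.Theorems.ClassRecordThreeEulerHalvesAtThreeWalkSupplyAtThreeSharp
import Summits.BirchSwinnertonDyer.BirchSwinnertonDyer.Theorems.ClassRecordThreeEulerHalvesAtThreeWalkFamiliesAdmPrime
import Summits.BirchSwinnertonDyer.BirchSwinnertonDyer.Theorems.ClassRecordThreeEulerHalvesAtThreeWalkFinite
import Summits.BirchSwinnertonDyer.BirchSwinnertonDyer.Theorems.ClassRecordThreeEulerHalvesAtThreeWalkTildeSign
import Summits.BirchSwinnertonDyer.BirchSwinnertonDyer.Theorems.ClassRecordThreeEulerHalvesAtThreeWalkOrders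
import Summits.BirchSwinnertonDyer.BirchSwinnertonDyer.Theorems.ClassRecordThreeEulerHalvesAtThreeKolyvaginRedefinition
import Literature.NumberTheory.QuadraticFields.HeegnerCondition
import HarnessLib

/-!
# `stub_jetchevMaxHLAtThree` ⟸ {five print facts} + {the per-frame supply} — FINAL form of this session:
# `hfin` and `hordκ` gone (theorems), S7♯ replaced by Gross Prop. 5.3 + pure Selmer membership, and the
# Prop. 4.7 ∕ 4.9 conjuncts stated at PRIME `ℓ` (cell `bsd-stepL`, seat `bsd-stepL-tam3-p1`, helper
# toward item 19109 `EulerHalvesAtThree`)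

HONEST FRAMING. Nothing here proves BSD, J₃ or the divisibility of any Heegner point; the registered
stub `stub_jetchevMaxHLAtThree` is NOT discharged — `hsupply` below is a hypothesis nothing in the tree
supplies yet; no item closes; 0 classes move (T7); `--supports stmt-BirchSwinnertonDyer-19109` (helper).
ERRATUM ∕ SUPERSESSION: the earlier displays p498607 (`…_of_admissibleSupply`) and p502546
(`…_of_sharpSupply`) inherit from p497855 the conjuncts `h47`, `h49` quantified over composite `ℓ` too —
stronger than print (see `…WalkFamiliesAdmPrime`); THIS display is built on the corrected walk
`Koly.tamagawaExponent_le_m_of_admissibleFamilies'` and is the one to cite.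
WHAT THIS FILE DOES. `jetchevMaxHLAtThree_of_facts_of_supply : h52 → hD36 → hrec → hGZ → hmod → hsupply
→ ‹stub VERBATIM›`, where `hsupply` = for every frame of the stub, `τ ≠ 1`, place `v` of `ℚ`, level
`k ≥ max(1, ord₃ c_v)`, admissible `(n, d)`: structures `𝒯` ∕ `𝒮` ∕ carrier places `Qcar`, data `D` on
the admissible conductors with `D n = d`, signs `eb`, `ε`, dual modules `C'`, and the conjuncts hS ·
hQcar · heb · hebε · **h53** (Gross Prop. 5.3 at admissible conductors, print) · **hdisj** ([J] §4.2)
· **hPT** (Thm 5.1 ∕ Lemma 5.2 (iii) per sign) · **hselmer** (Prop. 4.5–4.6 for the root classes) ·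
**h47** (Prop. 4.7, PRIME `ℓ`) · hC · **hdual_q** (Thm 5.1 at the carrier + (δ)) · **h49** (Prop. 4.9,
PRIME `ℓ`) · **hdual_ℓ** (Lemma 5.2 (iii) at λ for 𝓕₀). Inside: `hfin := JET.Walk.hfin_of_kummer`
(p503355), `hordκ := Koly.hordκ_of_admissibleData` (frame facts from the Heegner hypothesis and `d_K`
odd), `hκt := Koly.hκt_of_selmerMembership` with `hdivfin := divOrd_ne_top_of_levelIndex_eq_top`
(p502546), `τ`, `ρ̄` onto, `k ≥ 1`, admissibility from the frame.
References (locators only; no cited FACT declared): [cite: Jetchev2008, Thm. 1.4 (p. 812), §3.1,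
Prop. 4.5–4.9, Thm. 5.1, Lemma 5.2, Thm. 6.3, Prop. 6.4, Proof of Thm. 1.4 (pp. 816–825)]
[cite: McCallumLMS1991, §4 Prop. 4.4, Cor. 4.5, §5 Prop. 5.2] [cite: GrossLMS1991, §3–§5, Prop. 5.3,
Prop. 5.4] [cite: WZhang2014, Notations (xii)] [cite: SilvermanAEC2009, Lemma X.4.3, Cor. X.4.4].
Design: one theorem, no definitions; `K : Type`. Axioms: `propext`, `Classical.choice`, `Quot.sound`.
-/

set_option autoImplicit false

noncomputable section

open scoped Classical NumberField

namespace Summit.BirchSwinnertonDyer.Rank1Residual.X11b.Three.Koly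

open WeierstrassCurve IsDedekindDomain NumberField Field Literature.NumberTheory.EllipticCurves
  Literature.NumberTheory.EllipticCurves.ModularForms Literature.NumberTheory.EllipticCurves.Jetchev2008
  Literature.NumberTheory.EllipticCurves.KolyvaginCocycle
  Literature.NumberTheory.EllipticCurves.Rank1Residual Literature.NumberTheory.GaloisRepresentations
  Literature.NumberTheory.GaloisRepresentations.DiscreteGaloisModule
  Summit.BirchSwinnertonDyer.Rank1Residual.X11b Summit.BirchSwinnertonDyer.Rank1Residual.JET

/-- **`stub_jetchevMaxHLAtThree` VERBATIM ⟸ five print facts + the per-frame supply (final form)** — see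
the module docstring for the conjuncts of `hsupply` and for what is discharged inside (`hfin`, `hordκ`,
the algebraic and sign halves of S7♯, `hdivfin`, the frame facts). [cite: Jetchev2008, Thm. 1.4 (p. 812),
Proof of Thm. 1.4 (p. 825)] [cite: McCallumLMS1991, Prop. 5.2] [cite: GrossLMS1991, Prop. 5.3] -/
theorem jetchevMaxHLAtThree_of_facts_of_supply
    (h52 : McCallum1991.prop52_exists_conductor_kolyvaginClass_order_eq)
    (hD36 : ∀ (N : ℕ) [NeZero N] (W : WeierstrassCurve ℚ) (K : Type) [Field K] [NumberField K],
      phi_heegnerTau_mem_singularModuliField N W K)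
    (hrec : ∀ (N : ℕ) [NeZero N] (W : WeierstrassCurve ℚ) (K : Type) [Field K] [NumberField K],
      heegnerPointOfConductor_one_galoisConj N W K)
    (hGZ : ∀ (N : ℕ) [NeZero N] (W : WeierstrassCurve ℚ) (K : Type) [Field K] [NumberField K],
      gross_zagier N W K)
    (hmod : hasEntireLFunction_rat)
    (hsupply : ∀ (W : WeierstrassCurve ℚ) [W.IsElliptic] [W.IsGloballyMinimal] [NeZero (W.conductorNorm ℤ)]
      (K : Type) [Field K] [NumberField K]
      (Dt : ModularParametrizationData W (W.conductorNorm ℤ)) (β : ℤ) (ι : K →+* ℂ),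
      W.analyticRank = 1 → W.HasMultiplicativeReductionAtPrime 3 → Surj W 3 →
      IsImaginaryQuadratic K → SatisfiesHeegnerHypothesis (W.conductorNorm ℤ) K →
      Odd (NumberField.discr K) → (W.quadraticTwist (NumberField.discr K : ℚ)).entireLFunction 1 ≠ 0 →
      (4 * (W.conductorNorm ℤ : ℤ)) ∣ β ^ 2 - NumberField.discr K → ¬ (3 : ℤ) ∣ Dt.c →
      ∀ (τ : K ≃ₐ[ℚ] K), τ ≠ 1 → ∀ (v : HeightOneSpectrum (𝓞 ℚ)) (k : ℕ), 1 ≤ k →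
        padicValNat 3 (W.tamagawaNumberAt v) ≤ k →
      ∀ (n : ℕ) (d : KolyvaginHeegnerData Dt β ι n) (hn : Squarefree n ∧ ∀ q ∈ n.primeFactors,
        Zhang2014.IsKolyvaginPrime (W.conductorNorm ℤ) W K 3 q ∧ k ≤ Zhang2014.kolyvaginIndex W 3 q),
      ∃ (𝒯 𝒮 : SelmerStructure ((W.baseChange K).torsionGaloisModule ((3 ^ k : ℕ) : ℤ)))
        (Qcar : Finset (HeightOneSpectrum (𝓞 K)))
        (D : ∀ s : {m : ℕ // Squarefree m ∧ ∀ q ∈ m.primeFactors,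
        Zhang2014.IsKolyvaginPrime (W.conductorNorm ℤ) W K 3 q ∧ k ≤ Zhang2014.kolyvaginIndex W 3 q},
          KolyvaginHeegnerData Dt β ι s.1)
        (eb : ℕ → Bool) (ε : ℤ)
        (C' : ℕ → AddSubgroup (galoisCohomology ((W.baseChange K).torsionGaloisModule ((3 ^ k : ℕ) : ℤ)) 1)),
        D ⟨n, hn⟩ = d ∧
        (∀ (m ℓ : ℕ), ℓ.Prime → ¬ ℓ ∣ m → eb (m * ℓ) = !eb m) ∧
        (∀ m, (if eb m then (1 : ℤ) else -1) = ε * (-1) ^ m.primeFactors.card) ∧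
        (∀ (s s' : {m : ℕ // Squarefree m ∧ ∀ q ∈ m.primeFactors,
        Zhang2014.IsKolyvaginPrime (W.conductorNorm ℤ) W K 3 q ∧ k ≤ Zhang2014.kolyvaginIndex W 3 q})
      (hss' : s'.1 ∣ s.1) (τm : ringClassField K ι s'.1 ≃ₐ[ℚ] ringClassField K ι s'.1),
      (∀ x : ringClassField K ι s'.1, ((τm x : ringClassField K ι s'.1) : ℂ) = starRingEnd ℂ x) →
      ∃ σ' ∈ ringClassGal ι s'.1, IsOfFinAddOrder
        (pointGalHom W (ringClassField K ι s'.1) τm (D s').y -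
          ε • pointGalHom W (ringClassField K ι s'.1) σ' (D s').y)) ∧
        (∀ v, 𝒮 v ≤ (W.baseChange K).kummerSelmerStructure ((3 ^ k : ℕ) : ℤ) v) ∧
        (∀ v ∈ Qcar, ((W.conductorNorm ℤ : ℕ) : 𝓞 K) ∈ v.asIdeal) ∧
        (∀ (ℓ : ℕ), Zhang2014.IsKolyvaginPrime (W.conductorNorm ℤ) W K 3 ℓ →
      k ≤ Zhang2014.kolyvaginIndex W 3 ℓ → ∀ v : HeightOneSpectrum (𝓞 K), (ℓ : 𝓞 K) ∈ v.asIdeal →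
      Disjoint ((W.baseChange K).kummerSelmerStructure ((3 ^ k : ℕ) : ℤ) (Sum.inr v)) (𝒯 (Sum.inr v))) ∧
        (∀ (s : {m : ℕ // Squarefree m ∧ ∀ q ∈ m.primeFactors,
        Zhang2014.IsKolyvaginPrime (W.conductorNorm ℤ) W K 3 q ∧ k ≤ Zhang2014.kolyvaginIndex W 3 q})
      (ℓ : ℕ), Zhang2014.IsKolyvaginPrime (W.conductorNorm ℤ) W K 3 ℓ →
      k ≤ Zhang2014.kolyvaginIndex W 3 ℓ → ¬ ℓ ∣ s.1 →
      ∀ v : HeightOneSpectrum (𝓞 K), (ℓ : 𝓞 K) ∈ v.asIdeal → ∀ b : Bool,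
      Nat.card ((signPart W K τ ((3 ^ k : ℕ) : ℤ) (if b then 1 else -1)
          ((selmerF W ((3 ^ k : ℕ) : ℤ) 𝒯 (placesDividing K s.1)).relaxedAt {v}).selmerGroup).map
        (galoisCohomology.localization ((W.baseChange K).torsionGaloisModule ((3 ^ k : ℕ) : ℤ))
          (Sum.inr v) 1)) = 3 ^ k) ∧
        (∀ s (u : ℕ) (Q : (W.baseChange (ringClassField K ι s.1)).toAffine.Point)
      (hAk : IsAdmissible (absoluteGaloisGroup K) (D s).pointsSubgroup ((3 ^ k : ℕ) : ℤ))
      (hQ : (D s).toGeomPoints Q ∈ invPoints (absoluteGaloisGroup K) (D s).pointsSubgroup ((3 ^ k : ℕ) : ℤ)),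
      ((3 ^ u : ℕ) : ℤ) • Q = (D s).derivedPoint →
      (¬ ∃ Q' : (W.baseChange (ringClassField K ι s.1)).toAffine.Point,
        ((3 ^ (u + 1) : ℕ) : ℤ) • Q' = (D s).derivedPoint) →
      ((u + k : ℕ) : ℕ∞) ≤ Zhang2014.levelIndex W 3 s.1 →
      (kolyvaginClass (W.baseChange K) ((3 ^ k : ℕ) : ℤ)
        ((W.baseChange K).zsmul_geomPoints_surjective_of_charZero
          (by exact_mod_cast pow_ne_zero k Nat.prime_three.ne_zero)) hAk ((D s).toGeomPoints Q) hQ :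
          galoisCohomology ((W.baseChange K).torsionGaloisModule ((3 ^ k : ℕ) : ℤ)) 1) ∈
        (selmerF W ((3 ^ k : ℕ) : ℤ) 𝒯 (placesDividing K s.1)).selmerGroup) ∧
        (∀ (s s' : {m : ℕ // Squarefree m ∧ ∀ q ∈ m.primeFactors,
        Zhang2014.IsKolyvaginPrime (W.conductorNorm ℤ) W K 3 q ∧ k ≤ Zhang2014.kolyvaginIndex W 3 q}) (ℓ : ℕ),
      ℓ.Prime → ¬ ℓ ∣ s.1 → s'.1 = s.1 * ℓ →
      ∀ v : HeightOneSpectrum (𝓞 K), (ℓ : 𝓞 K) ∈ v.asIdeal →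
      addOrderOf (galoisCohomology.localization ((W.baseChange K).torsionGaloisModule ((3 ^ k : ℕ) : ℤ))
          (Sum.inr v) 1 ((D s').kolyvaginClass Nat.prime_three k)) =
        addOrderOf (galoisCohomology.localization ((W.baseChange K).torsionGaloisModule ((3 ^ k : ℕ) : ℤ))
          (Sum.inr v) 1 ((D s).kolyvaginClass Nat.prime_three k))) ∧
        (∀ m, C' m ≤ signPart W K τ ((3 ^ k : ℕ) : ℤ) (if !eb m then 1 else -1) ⊤) ∧
        (∀ s : {m : ℕ // Squarefree m ∧ ∀ q ∈ m.primeFactors,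
        Zhang2014.IsKolyvaginPrime (W.conductorNorm ℤ) W K 3 q ∧ k ≤ Zhang2014.kolyvaginIndex W 3 q},
      ∃ (Qg Qg' : Type) (_ : AddCommGroup Qg) (_ : AddCommGroup Qg') (_ : Finite Qg')
        (locq : signPart W K τ ((3 ^ k : ℕ) : ℤ) (if !eb s.1 then 1 else -1)
            (selmerF W ((3 ^ k : ℕ) : ℤ) 𝒯 (placesDividing K s.1)).selmerGroup →+ Qg)
        (locq' : C' s.1 →+ Qg'),
        (∀ x : C' s.1, locq' x = 0 ↔
          (x : galoisCohomology ((W.baseChange K).torsionGaloisModule ((3 ^ k : ℕ) : ℤ)) 1) ∈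
            signPart W K τ ((3 ^ k : ℕ) : ℤ) (if !eb s.1 then 1 else -1)
              (selmerF W ((3 ^ k : ℕ) : ℤ) 𝒯 (placesDividing K s.1)).selmerGroup) ∧
        Nat.card locq.range * Nat.card locq'.range = Nat.card Qg' ∧ IsAddCyclic Qg' ∧
        Nat.card Qg' = 3 ^ padicValNat 3 (W.tamagawaNumberAt v)) ∧
        (∀ (s s' : {m : ℕ // Squarefree m ∧ ∀ q ∈ m.primeFactors,
        Zhang2014.IsKolyvaginPrime (W.conductorNorm ℤ) W K 3 q ∧ k ≤ Zhang2014.kolyvaginIndex W 3 q}) (ℓ : ℕ),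
      ℓ.Prime → ¬ ℓ ∣ s.1 → s'.1 = s.1 * ℓ →
      ∀ v : HeightOneSpectrum (𝓞 K), (ℓ : 𝓞 K) ∈ v.asIdeal →
      ((D s').kolyvaginClass Nat.prime_three k :
          galoisCohomology ((W.baseChange K).torsionGaloisModule ((3 ^ k : ℕ) : ℤ)) 1) ∈
        signPart W K τ ((3 ^ k : ℕ) : ℤ) (if !eb s.1 then 1 else -1)
          (((selmerF0 W ((3 ^ k : ℕ) : ℤ) 𝒯 𝒮 (placesDividing K s.1) Qcar).relaxedAt {v}).selmerGroup)) ∧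
        (∀ (s : {m : ℕ // Squarefree m ∧ ∀ q ∈ m.primeFactors,
        Zhang2014.IsKolyvaginPrime (W.conductorNorm ℤ) W K 3 q ∧ k ≤ Zhang2014.kolyvaginIndex W 3 q})
      (ℓ : ℕ), Zhang2014.IsKolyvaginPrime (W.conductorNorm ℤ) W K 3 ℓ →
      k ≤ Zhang2014.kolyvaginIndex W 3 ℓ → ¬ ℓ ∣ s.1 →
      ∀ v : HeightOneSpectrum (𝓞 K), (ℓ : 𝓞 K) ∈ v.asIdeal →
      ∃ (Sg : Type) (_ : AddCommGroup Sg)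
        (sing : signPart W K τ ((3 ^ k : ℕ) : ℤ) (if !eb s.1 then 1 else -1)
            (((selmerF0 W ((3 ^ k : ℕ) : ℤ) 𝒯 𝒮 (placesDividing K s.1) Qcar).relaxedAt {v}).selmerGroup)
          →+ Sg),
        (∀ x, sing x = 0 ↔
          (x : galoisCohomology ((W.baseChange K).torsionGaloisModule ((3 ^ k : ℕ) : ℤ)) 1) ∈
            signPart W K τ ((3 ^ k : ℕ) : ℤ) (if !eb s.1 then 1 else -1)
              ((selmerF0 W ((3 ^ k : ℕ) : ℤ) 𝒯 𝒮 (placesDividing K s.1) Qcar).selmerGroup)) ∧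
        Nat.card sing.range *
          Nat.card ((C' s.1).map (galoisCohomology.localization
            ((W.baseChange K).torsionGaloisModule ((3 ^ k : ℕ) : ℤ)) (Sum.inr v) 1)) = 3 ^ k)) :
    ∀ (W : WeierstrassCurve ℚ) [W.IsElliptic] [W.IsGloballyMinimal] [NeZero (W.conductorNorm ℤ)]
      (K : Type) [Field K] [NumberField K]
      (Dt : ModularParametrizationData W (W.conductorNorm ℤ)) (β : ℤ) (ι : K →+* ℂ),
      W.analyticRank = 1 → W.HasMultiplicativeReductionAtPrime 3 → Surj W 3 →
      IsImaginaryQuadratic K → SatisfiesHeegnerHypothesis (W.conductorNorm ℤ) K →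
      Odd (NumberField.discr K) → (W.quadraticTwist (NumberField.discr K : ℚ)).entireLFunction 1 ≠ 0 →
      (4 * (W.conductorNorm ℤ : ℤ)) ∣ β ^ 2 - NumberField.discr K → ¬ (3 : ℤ) ∣ Dt.c →
      ∀ (v : HeightOneSpectrum (𝓞 ℚ)) (s : ℕ), s ≤ padicValNat 3 (W.tamagawaNumberAt v) →
        ∀ (n : ℕ) (d : KolyvaginHeegnerData Dt β ι n), Squarefree n →
          (∀ ℓ ∈ n.primeFactors, Zhang2014.IsKolyvaginPrime (W.conductorNorm ℤ) W K 3 ℓ ∧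
            s ≤ Zhang2014.kolyvaginIndex W 3 ℓ) → PDiv d 3 s := by
  refine jetchevMaxHLAtThree_of_facts_of_perLevel h52 hD36 hrec hGZ hmod ?_
  intro W _ _ _ K _ _ Dt β ι hr hmult hρ hK hHN hodd hLt hβ hc3 v k n d hsq hkol h1 h2 h3
  -- `k ≥ 1` and the admissibility of `n` at level `k`
  have hk : 1 ≤ k := by
    rcases Nat.eq_zero_or_pos k with rfl | hk
    · exact absurd h1 (by simp)
    · exact hk
  have hkM : (k : ℕ∞) ≤ Zhang2014.levelIndex W 3 n := le_trans le_self_add h3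
  have hn : Squarefree n ∧ ∀ q ∈ n.primeFactors,
      Zhang2014.IsKolyvaginPrime (W.conductorNorm ℤ) W K 3 q ∧ k ≤ Zhang2014.kolyvaginIndex W 3 q :=
    ⟨hsq, fun q hq ↦ ⟨hkol q hq, Zhang2014.natCast_le_levelIndex_iff.mp hkM q hq⟩⟩
  -- frame facts: complex conjugation, `(N, d_K) = 1`, `d_K < -4`
  obtain ⟨τ, hτ⟩ := exists_algEquiv_ne_one_of_isImaginaryQuadratic K hK
  have hND : IsCoprime ((W.conductorNorm ℤ : ℕ) : ℤ) (NumberField.discr K) :=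
    KolyvaginAssembly.isCoprime_discr_of_satisfiesHeegnerHypothesis hK hHN
  have hD : NumberField.discr K < -4 := by
    have hneg : NumberField.discr K < 0 := hK.discr_neg
    have h3split : SatisfiesHeegnerHypothesis 3 K :=
      SatisfiesHeegnerHypothesis.of_dvd (dvd_conductorNorm_of_mult (W := W) hmult) hHN
    have hpd : ¬ ((3 : ℕ) : ℤ) ∣ NumberField.discr K :=
      not_dvd_discr_of_split hK Nat.prime_three (by norm_num) h3split
    have hD3 : NumberField.discr K ≠ -3 := fun h ↦ hpd (h ▸ ⟨-1, by norm_num⟩)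
    have h4 : NumberField.discr K % 4 = 0 ∨ NumberField.discr K % 4 = 1 :=
      Literature.NumberTheory.QuadraticFields.Quadratic.discr_emod_four (K := K) hK.1
    obtain ⟨r, hr⟩ := hodd
    omega
  -- the supply at this frame
  obtain ⟨𝒯, 𝒮, Qcar, D, eb, ε, C', hDd, heb, hebε, h53, hS, hQcar, hdisj, hPT, hselmer, h47, hC,
    hdual_q, h49, hdual_ℓ⟩ := hsupply W K Dt β ι hr hmult hρ hK hHN hodd hLt hβ hc3 τ hτ v k hk h2 n d hn
  have hordκ := hordκ_of_admissibleData W hK hND hD (p := 3) (by norm_num) hρ Dt β ι k D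
  have hdivfin := fun s ↦ divOrd_ne_top_of_levelIndex_eq_top W K (hrec _ W K) (hGZ _ W K) hmod Dt β ι hr
    hK hHN hLt s (D s)
  have hfin := JET.Walk.hfin_of_kummer (K := K) W Nat.prime_three k 𝒯
  have hκt := hκt_of_selmerMembership W hK hND hD (p := 3) (by norm_num) hρ Dt β ι hτ hk 𝒯 D eb ε hebε
    h53 hdivfin hselmer
  have key := tamagawaExponent_le_m_of_admissibleFamilies' W K hK 3 (by decide) hρ Dt β ι τ hτ k
    (padicValNat 3 (W.tamagawaNumberAt v)) hk h2 𝒯 𝒮 hS Qcar hQcar D eb heb n hn ?_ ?_ hdisj hfin hPT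
    hκt hordκ h47 C' hC hdual_q h49 hdual_ℓ
  · rw [hDd] at key
    exact key
  · rw [hDd]; exact h1
  · rw [hDd]; exact h3

end Summit.BirchSwinnertonDyer.Rank1Residual.X11b.Three.Koly

end
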